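/-
Copyright (c) 2026 the pub-hodgecm-mathlib formalisation cell (harness21).  Prover seat hodgecm-mathlib-K2E4-p01 (g3), Track B ∕ K2-LIT,
h413 = `stmt-HodgeConjecture-24833`; #22S road, F-B re-cut (RK2_v): (GS^P⁺) = (GS^P) ★ p856267 WITH THE SHELL KIT EXPOSED on the same ray.  2026-09-04.
-/
import Summits.HodgeConjecture.HodgeConjecture.Theorems.K2E3GLTwoRamifiedRayUnipotentShell   -- ★ FILE N (this seat): deepest shell + coherent-positivity criterion; transitively E W M
import HarnessLib

/-!
# h413 ∕ Track B «K2-LIT» — (GS^P⁺): the central germ structure on `P = GL₂(F) × GL₁(F)` (★ `K2E3GLTwoCentralGermRamifiedRay`) RE-RUN with the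
# SHELL KIT exposed on the SAME ray — the deepest shell `y_n ~ γ_n`, `y_n → (z·η, c)`, and the coherent-positivity criterion of ★ FILE N

Cell `pub/hodgecm-mathlib`, crux H413 = `stmt-HodgeConjecture-24833` (supports-only).  Socket #22S is ★ p855314 `weakMatrixFiniteTransport_of_germStructure`
modulo `hGS` (= (GS_v′), ★ p856291) and `hRK` (two explicit `Δ‴_v`-transfer pairs with independent germ pairs ON THE SAME RAY).  The ray of ★ (GS^P) is
hidden under its `∃`; the frame-level construction of `hRK` (next files: transport `K2E3CentralGermStructureShellKitSplit`, witnesses `K2E4SplitTransferRankTwo`)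
needs two more facts ABOUT THAT RAY, so this file re-runs ★ FILE M's proof and appends them inside the same existential:
**`exists_ellipticRay_orbitalIntegral_eq_add_mul_shellKit`** = the (GS^P) statement (`K2/K2E4-p01/g3/GSP.sig.lean` v2) `∧ ∃ y Y, (∀ n, y_n ~ γ_n) ∧ Y = (z·η, c·1₁)
(by its matrix) ∧ y_n → Y ∧ «coherent positivity ⇒ ∀ᶠ n, O_{γ_n}^{ν∕ρ}(ψ) ≠ 0»` (★ FILE N `tendsto_deepShell`, `eventually_orbitalIntegral_ne_zero_of_coherent`).

HONEST LABEL: HC_CM is proved only modulo the 7 printed citations (2 remaining named inputs: hLiu418 = `stmt-HodgeConjecture-24832`,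
h413 = `stmt-HodgeConjecture-24833`) until rung 0 closes; this file is an unconditional local theorem and moves no counter by itself.

## References
* [LabesseLanglands1979] J.-P. Labesse, R. P. Langlands, *L-indistinguishability for SL(2)*, Canad. J. Math. 31 (1979), §2 pp. 7–9.
* [HarishChandra1999AdmissibleDistributions] Harish-Chandra (DeBacker–Sally), *Admissible Invariant Distributions on Reductive p-adic Groups* (1999), Thm. 3.1.
* [Rogawski1990] J. D. Rogawski, *Automorphic Representations of Unitary Groups in Three Variables* (1990), §8.1 Props. 8.1.1–8.1.3 pp. 114–116; §4.9 p. 54.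
-/

set_option autoImplicit false
set_option linter.dupNamespace false

noncomputable section

open scoped ValuativeRel Matrix MatrixGroups ENNReal
open Matrix ValuativeRel MeasureTheory Measure Topology Filter
open Literature.MeasureTheory.Group Literature.NumberTheory.Automorphic Literature.NumberTheory.Automorphic.HermitianLatticeTree
open Literature.NumberTheory.Rogawski1990 (IsLocSmooth isLocSmooth_indicator)
open Summit.HodgeConjecture.HodgeConjecture.Cruxes.H413.K2E3GLTwoRamifiedShellShift
open Summit.HodgeConjecture.HodgeConjecture.Cruxes.H413.K2E3GLTwoRamifiedShellStabilizers
open Summit.HodgeConjecture.HodgeConjecture.Cruxes.H413.K2E3GLTwoRamifiedShellUnfolding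
open Summit.HodgeConjecture.HodgeConjecture.Cruxes.H413.K2E3GLTwoRamifiedTorusCompactCore
open Summit.HodgeConjecture.HodgeConjecture.Cruxes.H413.K2E3GLTwoRamifiedRayGermEngine
open Summit.HodgeConjecture.HodgeConjecture.Cruxes.H413.K2E3GLTwoRamifiedRayRankTwo
open Summit.HodgeConjecture.HodgeConjecture.Cruxes.H413.K2E3GLTwoCentralGermRamifiedRay
open Summit.HodgeConjecture.HodgeConjecture.Cruxes.H413

namespace Summit.HodgeConjecture.HodgeConjecture.Cruxes.H413.K2E3GLTwoCentralGermShellKit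

variable {F : Type*} [Field F] [ValuativeRel F] [TopologicalSpace F] [IsNonarchimedeanLocalField F]

set_option maxHeartbeats 800000 in
/-- **(GS^P⁺) — (GS^P) WITH THE SHELL KIT.**  The statement of ★ `K2E3GLTwoCentralGermRamifiedRay.exists_ellipticRay_orbitalIntegral_eq_add_mul` (two-term germ
expansion of the canonical orbital integrals of `P = GL₂(F) × GL₁(F)` on a ramified elliptic ray `γ_n → (z·1₂, c)`, central value, rank two) together with, ON THE
SAME RAY: a sequence `y_n` conjugate to `γ_n` converging to `Y = (z·η, c·1₁)`, `η = (1 0; 1 1)` (the regular-unipotent direction), and the criterion «a smooth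
`ψ`, phase-coherent on each class `{g γ_n g⁻¹}` (values in `c_n·ℝ_{≥0}`, `c_n ≠ 0`) and charging the deepest shells (`ψ(k y_n k⁻¹) ≠ 0`, `k ∈ K_P`, `n ≥ N`), has
`O_{γ_n}^{ν∕ρ}(ψ) ≠ 0` for all `n ≫ 0`».  Proof = ★ FILE M verbatim + ★ FILE N.
[cite: LabesseLanglands1979, §2 pp. 7–9] [cite: HarishChandra1999AdmissibleDistributions, Thm. 3.1] [cite: Rogawski1990, §8.1 Props. 8.1.1–8.1.3 pp. 114–116] -/
theorem exists_ellipticRay_orbitalIntegral_eq_add_mul_shellKit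
    [MeasurableSpace (GL (Fin 2) F × GL (Fin 1) F)] [BorelSpace (GL (Fin 2) F × GL (Fin 1) F)]
    [T2Space (GL (Fin 2) F × GL (Fin 1) F)] [LocallyCompactSpace (GL (Fin 2) F × GL (Fin 1) F)]
    [SecondCountableTopology (GL (Fin 2) F × GL (Fin 1) F)]
    [∀ γ : GL (Fin 2) F × GL (Fin 1) F,
      MeasurableSpace ((GL (Fin 2) F × GL (Fin 1) F) ⧸ Subgroup.centralizer ({γ} : Set (GL (Fin 2) F × GL (Fin 1) F)))]
    [∀ γ : GL (Fin 2) F × GL (Fin 1) F,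
      BorelSpace ((GL (Fin 2) F × GL (Fin 1) F) ⧸ Subgroup.centralizer ({γ} : Set (GL (Fin 2) F × GL (Fin 1) F)))]
    (ν : Measure (GL (Fin 2) F × GL (Fin 1) F)) [ν.IsHaarMeasure] [ν.IsMulRightInvariant] (z c : Fˣ) :
    ∃ (γ : ℕ → GL (Fin 2) F × GL (Fin 1) F) (G : ℕ → ℂ) (lam lam' : ℂ),
      (∀ n, ((γ n).1 : Matrix (Fin 2) (Fin 2) F).trace ^ 2 - 4 * ((γ n).1 : Matrix (Fin 2) (Fin 2) F).det ≠ 0 ∧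
        (((γ n).1 : Matrix (Fin 2) (Fin 2) F).charpoly).eval (((γ n).2 : Matrix (Fin 1) (Fin 1) F) 0 0) ≠ 0) ∧
      (∀ n, ∃ ρ : Measure (Subgroup.centralizer ({γ n} : Set (GL (Fin 2) F × GL (Fin 1) F))),
        ρ.IsHaarMeasure ∧ ρ.IsInvInvariant ∧ ρ (compactCore (Subgroup.centralizer ({γ n} : Set (GL (Fin 2) F × GL (Fin 1) F)))) = 1) ∧
      Tendsto γ atTop (𝓝 (Units.map (Matrix.scalar (Fin 2) : F →+* Matrix (Fin 2) (Fin 2) F).toMonoidHom z,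
        Units.map (Matrix.scalar (Fin 1) : F →+* Matrix (Fin 1) (Fin 1) F).toMonoidHom c)) ∧
      (Set.range G).Infinite ∧ lam ≠ 0 ∧
      (∀ ψ : GL (Fin 2) F × GL (Fin 1) F → ℂ, IsLocSmooth ψ →
        ∃ a b : ℂ,
          (∀ᶠ n in atTop, ∀ (ρ : Measure (Subgroup.centralizer ({γ n} : Set (GL (Fin 2) F × GL (Fin 1) F))))
              [ρ.IsHaarMeasure] [ρ.IsInvInvariant],
              ρ (compactCore (Subgroup.centralizer ({γ n} : Set (GL (Fin 2) F × GL (Fin 1) F)))) = 1 →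
              orbitalIntegral (γ n) ψ
                (quotientMeasure (Subgroup.centralizer ({γ n} : Set (GL (Fin 2) F × GL (Fin 1) F))) ρ
                  (isClosed_coe_centralizer_singleton (γ n)) ν) = a + b * G n) ∧
          ψ (Units.map (Matrix.scalar (Fin 2) : F →+* Matrix (Fin 2) (Fin 2) F).toMonoidHom z,
              Units.map (Matrix.scalar (Fin 1) : F →+* Matrix (Fin 1) (Fin 1) F).toMonoidHom c) = lam * a + lam' * b) ∧
      (∃ (ψ₁ ψ₂ : GL (Fin 2) F × GL (Fin 1) F → ℂ) (a₁ b₁ a₂ b₂ : ℂ), IsLocSmooth ψ₁ ∧ IsLocSmooth ψ₂ ∧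
        (∀ᶠ n in atTop, ∀ (ρ : Measure (Subgroup.centralizer ({γ n} : Set (GL (Fin 2) F × GL (Fin 1) F))))
            [ρ.IsHaarMeasure] [ρ.IsInvInvariant],
            ρ (compactCore (Subgroup.centralizer ({γ n} : Set (GL (Fin 2) F × GL (Fin 1) F)))) = 1 →
            orbitalIntegral (γ n) ψ₁
              (quotientMeasure (Subgroup.centralizer ({γ n} : Set (GL (Fin 2) F × GL (Fin 1) F))) ρ
                (isClosed_coe_centralizer_singleton (γ n)) ν) = a₁ + b₁ * G n) ∧
        (∀ᶠ n in atTop, ∀ (ρ : Measure (Subgroup.centralizer ({γ n} : Set (GL (Fin 2) F × GL (Fin 1) F))))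
            [ρ.IsHaarMeasure] [ρ.IsInvInvariant],
            ρ (compactCore (Subgroup.centralizer ({γ n} : Set (GL (Fin 2) F × GL (Fin 1) F)))) = 1 →
            orbitalIntegral (γ n) ψ₂
              (quotientMeasure (Subgroup.centralizer ({γ n} : Set (GL (Fin 2) F × GL (Fin 1) F))) ρ
                (isClosed_coe_centralizer_singleton (γ n)) ν) = a₂ + b₂ * G n) ∧
        a₁ * b₂ - a₂ * b₁ ≠ 0) ∧
      (∃ (y : ℕ → GL (Fin 2) F × GL (Fin 1) F) (Y : GL (Fin 2) F × GL (Fin 1) F),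
        (∀ n, ∃ g : GL (Fin 2) F × GL (Fin 1) F, y n = g * γ n * g⁻¹) ∧
        (Y.1 : Matrix (Fin 2) (Fin 2) F) = !![(z : F), 0; z, z] ∧
        Y.2 = Units.map (Matrix.scalar (Fin 1) : F →+* Matrix (Fin 1) (Fin 1) F).toMonoidHom c ∧
        Tendsto y atTop (𝓝 Y) ∧
        (∀ ψ : GL (Fin 2) F × GL (Fin 1) F → ℂ, IsLocSmooth ψ →
          (∀ n, ∃ cst : ℂ, cst ≠ 0 ∧ ∀ g : GL (Fin 2) F × GL (Fin 1) F, ∃ t : ℝ, 0 ≤ t ∧ ψ (g * γ n * g⁻¹) = cst * t) →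
          (∃ N, ∀ n, N ≤ n → ∀ k ∈ (glInt 2 F).prod (glInt 1 F), ψ (k * y n * k⁻¹) ≠ 0) →
          ∀ᶠ n in atTop, ∃ r : ℂ, r ≠ 0 ∧ ∀ (ρ : Measure (Subgroup.centralizer ({γ n} : Set (GL (Fin 2) F × GL (Fin 1) F))))
              [ρ.IsHaarMeasure] [ρ.IsInvInvariant],
              ρ (compactCore (Subgroup.centralizer ({γ n} : Set (GL (Fin 2) F × GL (Fin 1) F)))) = 1 →
              orbitalIntegral (γ n) ψ
                (quotientMeasure (Subgroup.centralizer ({γ n} : Set (GL (Fin 2) F × GL (Fin 1) F))) ρ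
                  (isClosed_coe_centralizer_singleton (γ n)) ν) = r)) := by
  classical
  haveI : T2Space F := t2Space_of_isNonarchimedeanLocalField
  obtain ⟨ϖ, hϖ⟩ := exists_isUniformizingElement (F := F)
  -- an Eisenstein torus with non-zero discriminant (`τ² = ϖτ + ϖ` in characteristic `2`, `τ² = ϖ` otherwise), as in ★ C2
  obtain ⟨u, v, hu, hu1, hv1, hdisc⟩ : ∃ u v : F, u ∈ 𝒪[F] ∧ valuation F u < 1 ∧ valuation F v = valuation F ϖ ∧ u ^ 2 + 4 * v ≠ 0 := by
    have h4 : (4 : F) = 2 * 2 := by norm_num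
    by_cases h2 : (2 : F) = 0
    · refine ⟨ϖ, ϖ, hϖ.mem, hϖ.valuation_lt_one, rfl, ?_⟩
      rw [h4, h2, zero_mul, zero_mul, add_zero]
      exact pow_ne_zero _ hϖ.ne_zero
    · refine ⟨0, ϖ, Subring.zero_mem _, by rw [map_zero]; exact zero_lt_one, rfl, ?_⟩
      rw [zero_pow two_ne_zero, zero_add, h4]
      exact mul_ne_zero (mul_ne_zero h2 h2) hϖ.ne_zero
  have h0 := hϖ.ne_zero
  have hv : v ∈ 𝒪[F] := by rw [Valuation.mem_integer_iff, hv1]; exact hϖ.valuation_le_one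
  have hv0 : v ≠ 0 := fun h => by rw [h, map_zero] at hv1; exact (Valuation.ne_zero_iff _).2 h0 hv1.symm
  have hE := quadNormForm_integral_of_eisenstein hϖ hu hu1 hv1
  -- the centre `(z·1₂, c·1₁)`
  set zS := Units.map (Matrix.scalar (Fin 2) : F →+* Matrix (Fin 2) (Fin 2) F).toMonoidHom z with hzSdef
  set cu := Units.map (Matrix.scalar (Fin 1) : F →+* Matrix (Fin 1) (Fin 1) F).toMonoidHom c with hcudef
  have hzS : (zS : Matrix (Fin 2) (Fin 2) F) = !![(z : F), 0; 0, z] := by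
    rw [hzSdef, Units.coe_map]
    ext i j
    fin_cases i <;> fin_cases j <;> simp [Matrix.scalar_apply]
  have hcu : ((cu : Matrix (Fin 1) (Fin 1) F) 0 0) = (c : F) := by
    rw [hcudef, Units.coe_map]; simp [Matrix.scalar_apply]
  have hcomm : ∀ x : GL (Fin 2) F × GL (Fin 1) F, ((zS, cu) : GL (Fin 2) F × GL (Fin 1) F) * x = x * (zS, cu) := fun x =>
    Prod.ext (units_map_scalar_mul_comm z x.1) (glOne_mul_comm cu x.2)
  -- the torus, the deep ray `γ_n = z(1 + ϖⁿτ)`, the shell representatives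
  set γτ : GL (Fin 2) F := Matrix.GeneralLinearGroup.mkOfDetNeZero !![0, v; 1, u] (by rw [Matrix.det_fin_two]; simp [hv0]) with hγτdef
  have hγτ : (γτ : Matrix (Fin 2) (Fin 2) F) = !![0, v; 1, u] := rfl
  have hδ : ∀ n : ℕ, valuation F (1 + ϖ ^ n * u - ϖ ^ (2 * n) * v) = 1 := fun n => by
    have h1 : valuation F (ϖ ^ n * u - ϖ ^ (2 * n) * v) < 1 := by
      refine lt_of_le_of_lt (Valuation.map_sub _ _ _) (max_lt ?_ ?_)
      · rw [map_mul, map_pow]; exact mul_lt_one_of_nonneg_of_lt_one_right (pow_le_one₀ zero_le hϖ.valuation_lt_one.le) zero_le hu1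
      · rw [map_mul, map_pow, hv1]
        exact mul_lt_one_of_nonneg_of_lt_one_right (pow_le_one₀ zero_le hϖ.valuation_lt_one.le) zero_le hϖ.valuation_lt_one
    rw [add_sub_assoc, Valuation.map_one_add_of_lt _ h1]
  have hdet : ∀ n : ℕ, Matrix.det !![(z : F), z * ϖ ^ n * v; z * ϖ ^ n, z + z * ϖ ^ n * u] ≠ 0 := fun n => by
    have : Matrix.det !![(z : F), z * ϖ ^ n * v; z * ϖ ^ n, z + z * ϖ ^ n * u] = (z : F) ^ 2 * (1 + ϖ ^ n * u - ϖ ^ (2 * n) * v) := by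
      rw [Matrix.det_fin_two]; simp; ring
    rw [this]
    refine mul_ne_zero (pow_ne_zero _ z.ne_zero) fun h => ?_
    have := hδ n
    rw [h, map_zero] at this
    exact zero_ne_one this
  set γ : ℕ → GL (Fin 2) F := fun n => Matrix.GeneralLinearGroup.mkOfDetNeZero _ (hdet n) with hγdef
  have hγ : ∀ n, (γ n : Matrix (Fin 2) (Fin 2) F) = !![(z : F), z * ϖ ^ n * v; z * ϖ ^ n, z + z * ϖ ^ n * u] := fun n => rfl
  have hb : ∀ n : ℕ, (z : F) * ϖ ^ n ≠ 0 := fun n => mul_ne_zero z.ne_zero (pow_ne_zero _ h0)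
  set rm : ℕ → GL (Fin 2) F := fun m => Matrix.GeneralLinearGroup.mkOfDetNeZero (Matrix.diagonal ![(1 : F), ϖ ^ m])
    (by rw [Matrix.det_diagonal]; simp [h0]) with hrmdef
  have hrm : ∀ m, (rm m : Matrix (Fin 2) (Fin 2) F) = Matrix.diagonal ![(1 : F), ϖ ^ m] := fun m => rfl
  have hCn : ∀ n, Subgroup.centralizer ({γ n} : Set (GL (Fin 2) F)) = Subgroup.centralizer ({γτ} : Set (GL (Fin 2) F)) := fun n =>
    centralizer_deep_eq_centralizer_companion (hb n) (hγ n) hγτ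
  have hdisc' : ∀ n, (γ n : Matrix (Fin 2) (Fin 2) F).trace ^ 2 - 4 * (γ n : Matrix (Fin 2) (Fin 2) F).det ≠ 0 := fun n => by
    rw [trace_sq_sub_four_mul_det_regRep u v (z : F) (z * ϖ ^ n) (hγ n)]
    exact mul_ne_zero (pow_ne_zero _ (hb n)) hdisc
  have heval : ∀ n, ((γ n : Matrix (Fin 2) (Fin 2) F).charpoly).eval ((cu : Matrix (Fin 1) (Fin 1) F) 0 0) ≠ 0 := fun n => by
    rw [hcu]; exact eval_charpoly_regRep_ne_zero hϖ hE (hb n) (c : F) (hγ n)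
  have hOcl : ∀ n, IsClosed {g : GL (Fin 2) F × GL (Fin 1) F | ∃ y : GL (Fin 2) F × GL (Fin 1) F, y * (γ n, cu) * y⁻¹ = g} := fun n =>
    isClosed_conjClass_pair (γ n) (hdisc' n) cu
  -- `K_P`, `q = |𝓀|`, `w = ν(K_P)`
  have hKo : IsOpen (((glInt 2 F).prod (glInt 1 F) : Subgroup (GL (Fin 2) F × GL (Fin 1) F)) : Set (GL (Fin 2) F × GL (Fin 1) F)) := isOpen_prodGlInt
  have hKc : IsCompact (((glInt 2 F).prod (glInt 1 F) : Subgroup (GL (Fin 2) F × GL (Fin 1) F)) : Set (GL (Fin 2) F × GL (Fin 1) F)) :=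
    isCompact_prodGlInt
  have hcard : 1 < Nat.card (IsLocalRing.ResidueField 𝒪[F]) := Finite.one_lt_card
  have hq1 : (Nat.card (IsLocalRing.ResidueField 𝒪[F]) : ℂ) - 1 ≠ 0 := by
    have h1 : (Nat.card (IsLocalRing.ResidueField 𝒪[F]) : ℂ) ≠ 1 := by exact_mod_cast hcard.ne'
    exact sub_ne_zero.2 h1
  have hq0 : (Nat.card (IsLocalRing.ResidueField 𝒪[F]) : ℂ) ≠ 0 := by exact_mod_cast (zero_lt_one.trans hcard).ne'
  have hw0 : ((ν ((glInt 2 F).prod (glInt 1 F))).toReal : ℂ) ≠ 0 := by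
    rw [Complex.ofReal_ne_zero, ENNReal.toReal_ne_zero]
    exact ⟨(hKo.measure_pos ν ⟨1, Subgroup.one_mem _⟩).ne', hKc.measure_lt_top.ne⟩
  -- (iii) the germ of an arbitrary smooth `ψ`: finite `K_P`-average `Ψ`, then ★ FILE E on `Ψ`, then `O(Ψ) = nK·O(ψ)` (★ FILE M §1)
  have hmain : ∀ ψ : GL (Fin 2) F × GL (Fin 1) F → ℂ, IsLocSmooth ψ →
      ∃ a b : ℂ,
        (∀ᶠ n in atTop, ∀ (ρ : Measure (Subgroup.centralizer ({((γ n, cu) : GL (Fin 2) F × GL (Fin 1) F)} : Set (GL (Fin 2) F × GL (Fin 1) F))))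
            [ρ.IsHaarMeasure] [ρ.IsInvInvariant],
            ρ (compactCore (Subgroup.centralizer ({((γ n, cu) : GL (Fin 2) F × GL (Fin 1) F)} : Set (GL (Fin 2) F × GL (Fin 1) F)))) = 1 →
            orbitalIntegral (γ n, cu) ψ
              (quotientMeasure (Subgroup.centralizer ({((γ n, cu) : GL (Fin 2) F × GL (Fin 1) F)} : Set (GL (Fin 2) F × GL (Fin 1) F))) ρ
                (isClosed_coe_centralizer_singleton (γ n, cu)) ν) = a + b * (Nat.card (IsLocalRing.ResidueField 𝒪[F]) : ℂ) ^ n) ∧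
        ψ (zS, cu) = -((Nat.card (IsLocalRing.ResidueField 𝒪[F]) : ℂ) - 1) / ((ν ((glInt 2 F).prod (glInt 1 F))).toReal : ℂ) * a + 0 * b := by
    intro ψ hψ
    obtain ⟨nK, kf, hnK, -, hinv⟩ :=
      Literature.Topology.exists_finset_conj_sum_invariant_of_hasCompactSupport (K := (glInt 2 F).prod (glInt 1 F)) hKc hψ.1 hψ.2
    obtain ⟨Ψ, hΨ⟩ : ∃ Ψ : GL (Fin 2) F × GL (Fin 1) F → ℂ, Ψ = fun x => ∑ i, ψ (kf i * x * (kf i)⁻¹) := ⟨_, rfl⟩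
    have hΨs : IsLocSmooth Ψ := by
      rw [hΨ]; exact ⟨Literature.Topology.isLocallyConstant_sum_conj hψ.1 kf, Literature.Topology.hasCompactSupport_sum_conj hψ.2 kf⟩
    have hΨK : ∀ k ∈ (glInt 2 F).prod (glInt 1 F), ∀ y, Ψ (k * y * k⁻¹) = Ψ y := fun k hk y => by rw [hΨ]; exact hinv k hk y
    have hnK0 : (nK : ℂ) ≠ 0 := by exact_mod_cast hnK.ne'
    -- a right-invariance level `m ≥ 1` of `Ψ` in the `GL₂` variable
    obtain ⟨V, hV, hVΨ⟩ := Literature.Topology.exists_nhds_one_forall_mul_eq_of_hasCompactSupport hΨs.1 hΨs.2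
    have hU : (fun g : GL (Fin 2) F => ((g, 1) : GL (Fin 2) F × GL (Fin 1) F)) ⁻¹' V ∈ 𝓝 (1 : GL (Fin 2) F) :=
      (continuous_id.prodMk continuous_const).continuousAt.preimage_mem_nhds (by exact hV)
    obtain ⟨m, hm, hmU⟩ := exists_congruenceGL_pow_subset hϖ hU
    have hright : ∀ k ∈ congruenceGL 2 (valuation F ϖ ^ m), ∀ x : GL (Fin 2) F, Ψ (x * k, cu) = Ψ (x, cu) := fun k hk x => by
      have := hVΨ (x, cu) (k, 1) (hmU hk)
      simpa only [Prod.mk_mul_mk, mul_one] using this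
    -- a shell bound of the support at depth `m`; the explicit germ of `Ψ` (★ FILE E); `Ψ(z·1₂,c) = nK·ψ(z·1₂,c)`
    obtain ⟨R, hR⟩ := exists_forall_le_apply_shellConj_eq_zero hϖ hu hv hE hγτ (hCn m) cu hrm (hOcl m) hΨs.2 hΨK
    have hgerm := fun k : ℕ => orbitalIntegral_deep_eq_closedForm hϖ hu hu1 hv1 hdisc z cu hγτ hγ hrm hzS ν hΨs.continuous hΨs.2 hΨK hm hright hR k
    have hcent : Ψ (zS, cu) = (nK : ℂ) * ψ (zS, cu) := by
      have h1 : ∀ i, kf i * ((zS, cu) : GL (Fin 2) F × GL (Fin 1) F) * (kf i)⁻¹ = (zS, cu) := fun i => by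
        rw [← hcomm (kf i), mul_inv_cancel_right]
      simp only [hΨ, h1, Finset.sum_const, Finset.card_univ, Fintype.card_fin, nsmul_eq_mul]
    refine ⟨-(((ν ((glInt 2 F).prod (glInt 1 F))).toReal : ℂ) * ψ (zS, cu)) / ((Nat.card (IsLocalRing.ResidueField 𝒪[F]) : ℂ) - 1),
      (nK : ℂ)⁻¹ * ((ν ((glInt 2 F).prod (glInt 1 F))).toReal : ℂ) *
        ((∑ r ∈ Finset.range R, ((Nat.card (IsLocalRing.ResidueField 𝒪[F]) : ℂ) ^ r) *
            Ψ ((((rm r)⁻¹, 1) : GL (Fin 2) F × GL (Fin 1) F) * (γ m, cu) * (((rm r)⁻¹, 1) : GL (Fin 2) F × GL (Fin 1) F)⁻¹)) +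
          (nK : ℂ) * ψ (zS, cu) / ((Nat.card (IsLocalRing.ResidueField 𝒪[F]) : ℂ) - 1)) /
        (Nat.card (IsLocalRing.ResidueField 𝒪[F]) : ℂ) ^ m, ?_, ?_⟩
    · refine Filter.eventually_atTop.2 ⟨m, fun n hn => ?_⟩
      obtain ⟨k, rfl⟩ := Nat.exists_eq_add_of_le hn
      intro ρ _ _ hρ
      have h1 := hgerm k ρ hρ
      have h2 : orbitalIntegral (γ (m + k), cu) Ψ (quotientMeasure (Subgroup.centralizer ({(γ (m + k), cu)} : Set (GL (Fin 2) F × GL (Fin 1) F))) ρ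
          (isClosed_coe_centralizer_singleton (γ (m + k), cu)) ν) =
          (nK : ℂ) * orbitalIntegral (γ (m + k), cu) ψ (quotientMeasure (Subgroup.centralizer ({(γ (m + k), cu)} : Set (GL (Fin 2) F × GL (Fin 1) F))) ρ
          (isClosed_coe_centralizer_singleton (γ (m + k), cu)) ν) := by
        rw [hΨ]; exact orbitalIntegral_sum_conj_eq (γ (m + k), cu) (hOcl (m + k)) hψ.continuous hψ.2 kf ρ ν
      have h3 : orbitalIntegral (γ (m + k), cu) ψ (quotientMeasure (Subgroup.centralizer ({(γ (m + k), cu)} : Set (GL (Fin 2) F × GL (Fin 1) F))) ρ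
          (isClosed_coe_centralizer_singleton (γ (m + k), cu)) ν) =
          (nK : ℂ)⁻¹ * orbitalIntegral (γ (m + k), cu) Ψ (quotientMeasure (Subgroup.centralizer ({(γ (m + k), cu)} : Set (GL (Fin 2) F × GL (Fin 1) F))) ρ
          (isClosed_coe_centralizer_singleton (γ (m + k), cu)) ν) := by
        rw [h2, ← mul_assoc, inv_mul_cancel₀ hnK0, one_mul]
      refine h3.trans ?_
      rw [h1, hcent]
      rw [pow_add]
      field_simp
      ring
    · rw [zero_mul, add_zero]
      field_simp
  refine ⟨fun n => (γ n, cu), fun n => (Nat.card (IsLocalRing.ResidueField 𝒪[F]) : ℂ) ^ n,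
    -((Nat.card (IsLocalRing.ResidueField 𝒪[F]) : ℂ) - 1) / ((ν ((glInt 2 F).prod (glInt 1 F))).toReal : ℂ), 0, fun n => ⟨hdisc' n, heval n⟩,
    fun n => exists_isHaarMeasure_compactCore_centralizer_pair_eq_one hϖ hu hu1 hv1 hγτ (hCn n) cu,
    tendsto_deep hϖ hu hv (z : F) cu hγ hzS, ?_, div_ne_zero (neg_ne_zero.2 hq1) hw0, hmain, ?_, ?_⟩
  · -- `G_n = qⁿ` takes infinitely many values
    refine Set.infinite_range_of_injective fun a b hab => ?_
    have hab' : (Nat.card (IsLocalRing.ResidueField 𝒪[F])) ^ a = (Nat.card (IsLocalRing.ResidueField 𝒪[F])) ^ b := by exact_mod_cast hab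
    exact Nat.pow_right_injective hcard hab'
  · -- (iv) RANK TWO: the witnesses of ★ FILE W
    have hval0 : valuation F ϖ ^ 1 ≠ 0 := pow_ne_zero _ ((Valuation.ne_zero_iff _).2 h0)
    have hK'o : IsOpen (((congruenceGL 2 (valuation F ϖ ^ 1)).prod (glInt 1 F) : Subgroup (GL (Fin 2) F × GL (Fin 1) F)) : Set (GL (Fin 2) F × GL (Fin 1) F)) := by
      rw [Subgroup.coe_prod]; exact (isOpen_congruenceGL (n := 2) hval0).prod (isOpen_glInt 1 F)
    have hK'c : IsCompact (((congruenceGL 2 (valuation F ϖ ^ 1)).prod (glInt 1 F) : Subgroup (GL (Fin 2) F × GL (Fin 1) F)) : Set (GL (Fin 2) F × GL (Fin 1) F)) := by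
      rw [Subgroup.coe_prod]; exact (isCompact_congruenceGL (n := 2) _).prod (isCompact_glInt 1 F)
    -- the two test sets `U₁ = (z·1₂,c)·K_P`, `U₂ = (z·1₂,c)·(K(ϖ) × GL₁(𝒪))` and their indicators
    obtain ⟨U₁, hU₁⟩ : ∃ U : Set (GL (Fin 2) F × GL (Fin 1) F), U = (fun y => ((zS, cu) : GL (Fin 2) F × GL (Fin 1) F)⁻¹ * y) ⁻¹'
        (((glInt 2 F).prod (glInt 1 F) : Subgroup (GL (Fin 2) F × GL (Fin 1) F)) : Set (GL (Fin 2) F × GL (Fin 1) F)) := ⟨_, rfl⟩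
    obtain ⟨U₂, hU₂⟩ : ∃ U : Set (GL (Fin 2) F × GL (Fin 1) F), U = (fun y => ((zS, cu) : GL (Fin 2) F × GL (Fin 1) F)⁻¹ * y) ⁻¹'
        (((congruenceGL 2 (valuation F ϖ ^ 1)).prod (glInt 1 F) : Subgroup (GL (Fin 2) F × GL (Fin 1) F)) : Set (GL (Fin 2) F × GL (Fin 1) F)) := ⟨_, rfl⟩
    have hsm₁ : IsLocSmooth (U₁.indicator fun _ => (1 : ℂ)) := by
      rw [hU₁]
      refine isLocSmooth_indicator (hKo.preimage (continuous_const_mul _))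
        ((Subgroup.isClosed_of_isOpen _ hKo).preimage (continuous_const_mul _)) ?_
      exact (Homeomorph.isCompact_preimage (Homeomorph.mulLeft ((zS, cu) : GL (Fin 2) F × GL (Fin 1) F)⁻¹)).2 hKc
    have hsm₂ : IsLocSmooth (U₂.indicator fun _ => (1 : ℂ)) := by
      rw [hU₂]
      refine isLocSmooth_indicator (hK'o.preimage (continuous_const_mul _))
        ((Subgroup.isClosed_of_isOpen _ hK'o).preimage (continuous_const_mul _)) ?_
      exact (Homeomorph.isCompact_preimage (Homeomorph.mulLeft ((zS, cu) : GL (Fin 2) F × GL (Fin 1) F)⁻¹)).2 hK'c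
    obtain ⟨ψ₁, hψ₁⟩ : ∃ f : GL (Fin 2) F × GL (Fin 1) F → ℂ, f = U₁.indicator fun _ => (1 : ℂ) := ⟨_, rfl⟩
    obtain ⟨ψB, hψB⟩ : ∃ f : GL (Fin 2) F × GL (Fin 1) F → ℂ, f = U₂.indicator fun _ => (1 : ℂ) := ⟨_, rfl⟩
    have hsψ₁ : IsLocSmooth ψ₁ := by rw [hψ₁]; exact hsm₁
    have hsψB : IsLocSmooth ψB := by rw [hψB]; exact hsm₂
    have hsψ₂ : IsLocSmooth (ψ₁ - ψB) := ⟨hsψ₁.1.sub hsψB.1, hsψ₁.2.sub hsψB.2⟩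
    -- invariances (★ FILE W)
    have hK₁ : ∀ k ∈ (glInt 2 F).prod (glInt 1 F), ∀ y, ψ₁ (k * y * k⁻¹) = ψ₁ y := fun k hk y => by
      simp only [hψ₁, hU₁, Set.indicator_apply, Set.mem_preimage, SetLike.mem_coe, (mem_tests_conj_iff cu hcomm hk y (valuation F ϖ ^ 1)).1]
    have hKB : ∀ k ∈ (glInt 2 F).prod (glInt 1 F), ∀ y, ψB (k * y * k⁻¹) = ψB y := fun k hk y => by
      simp only [hψB, hU₂, Set.indicator_apply, Set.mem_preimage, SetLike.mem_coe, (mem_tests_conj_iff cu hcomm hk y (valuation F ϖ ^ 1)).2]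
    have hK₂ : ∀ k ∈ (glInt 2 F).prod (glInt 1 F), ∀ y, (ψ₁ - ψB) (k * y * k⁻¹) = (ψ₁ - ψB) y := fun k hk y => by
      simp only [Pi.sub_apply, hK₁ k hk y, hKB k hk y]
    have hright₁ : ∀ k ∈ congruenceGL 2 (valuation F ϖ ^ 1), ∀ x : GL (Fin 2) F, ψ₁ (x * k, cu) = ψ₁ (x, cu) := fun k hk x => by
      simp only [hψ₁, hU₁, Set.indicator_apply, Set.mem_preimage, SetLike.mem_coe, (mem_tests_mul_right_iff (zS := zS) cu hk x).1]
    have hrightB : ∀ k ∈ congruenceGL 2 (valuation F ϖ ^ 1), ∀ x : GL (Fin 2) F, ψB (x * k, cu) = ψB (x, cu) := fun k hk x => by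
      simp only [hψB, hU₂, Set.indicator_apply, Set.mem_preimage, SetLike.mem_coe, (mem_tests_mul_right_iff (zS := zS) cu hk x).2]
    have hright₂ : ∀ k ∈ congruenceGL 2 (valuation F ϖ ^ 1), ∀ x : GL (Fin 2) F, (ψ₁ - ψB) (x * k, cu) = (ψ₁ - ψB) (x, cu) :=
      fun k hk x => by simp only [Pi.sub_apply, hright₁ k hk x, hrightB k hk x]
    -- the shell values at depth one and the central values (★ FILE W `mem_tests_shellConj_one`, `mem_tests_centre`)
    have hshell := fun r : ℕ => mem_tests_shellConj_one hϖ z cu hu hv hγ hrm hzS r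
    have hv₁ : ∀ r, ψ₁ ((((rm r)⁻¹, 1) : GL (Fin 2) F × GL (Fin 1) F) * (γ 1, cu) * (((rm r)⁻¹, 1) : GL (Fin 2) F × GL (Fin 1) F)⁻¹) =
        if r ≤ 1 then 1 else 0 := fun r => by
      simp only [hψ₁, hU₁, Set.indicator_apply, Set.mem_preimage, SetLike.mem_coe, (hshell r).1]
    have hvB : ∀ r, ψB ((((rm r)⁻¹, 1) : GL (Fin 2) F × GL (Fin 1) F) * (γ 1, cu) * (((rm r)⁻¹, 1) : GL (Fin 2) F × GL (Fin 1) F)⁻¹) =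
        if r = 0 then 1 else 0 := fun r => by
      simp only [hψB, hU₂, Set.indicator_apply, Set.mem_preimage, SetLike.mem_coe, (hshell r).2]
    have hc₁ : ψ₁ (zS, cu) = 1 := by
      simp only [hψ₁, hU₁, Set.indicator_apply, Set.mem_preimage, SetLike.mem_coe, (mem_tests_centre (zS := zS) cu (valuation F ϖ ^ 1)).1, if_true]
    have hcB : ψB (zS, cu) = 1 := by
      simp only [hψB, hU₂, Set.indicator_apply, Set.mem_preimage, SetLike.mem_coe, (mem_tests_centre (zS := zS) cu (valuation F ϖ ^ 1)).2, if_true]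
    have hR₁ : ∀ r, 2 ≤ r → ψ₁ ((((rm r)⁻¹, 1) : GL (Fin 2) F × GL (Fin 1) F) * (γ 1, cu) * (((rm r)⁻¹, 1) : GL (Fin 2) F × GL (Fin 1) F)⁻¹) = 0 :=
      fun r hr => by rw [hv₁, if_neg (by omega)]
    have hR₂ : ∀ r, 2 ≤ r → (ψ₁ - ψB) ((((rm r)⁻¹, 1) : GL (Fin 2) F × GL (Fin 1) F) * (γ 1, cu) * (((rm r)⁻¹, 1) : GL (Fin 2) F × GL (Fin 1) F)⁻¹) = 0 :=
      fun r hr => by rw [Pi.sub_apply, hv₁, hvB, if_neg (by omega), if_neg (by omega), sub_zero]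
    -- ★ FILE E at depth `1 + k` for both witnesses; `S_1(ψ₁) = 1 + q`, `S_1(ψ₂) = q`
    have hgerm₁ := fun k : ℕ => orbitalIntegral_deep_eq_closedForm hϖ hu hu1 hv1 hdisc z cu hγτ hγ hrm hzS ν hsψ₁.continuous hsψ₁.2 hK₁ le_rfl hright₁ hR₁ k
    have hgerm₂ := fun k : ℕ => orbitalIntegral_deep_eq_closedForm hϖ hu hu1 hv1 hdisc z cu hγτ hγ hrm hzS ν hsψ₂.continuous hsψ₂.2 hK₂ le_rfl hright₂ hR₂ k
    have hS₁ : ∑ r ∈ Finset.range 2, ((Nat.card (IsLocalRing.ResidueField 𝒪[F]) : ℂ) ^ r) *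
        ψ₁ ((((rm r)⁻¹, 1) : GL (Fin 2) F × GL (Fin 1) F) * (γ 1, cu) * (((rm r)⁻¹, 1) : GL (Fin 2) F × GL (Fin 1) F)⁻¹) =
        1 + (Nat.card (IsLocalRing.ResidueField 𝒪[F]) : ℂ) := by
      rw [Finset.sum_range_succ, Finset.sum_range_succ, Finset.sum_range_zero, hv₁, hv₁, if_pos (by omega), if_pos le_rfl]
      ring
    have hS₂ : ∑ r ∈ Finset.range 2, ((Nat.card (IsLocalRing.ResidueField 𝒪[F]) : ℂ) ^ r) *
        (ψ₁ - ψB) ((((rm r)⁻¹, 1) : GL (Fin 2) F × GL (Fin 1) F) * (γ 1, cu) * (((rm r)⁻¹, 1) : GL (Fin 2) F × GL (Fin 1) F)⁻¹) =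
        (Nat.card (IsLocalRing.ResidueField 𝒪[F]) : ℂ) := by
      rw [Finset.sum_range_succ, Finset.sum_range_succ, Finset.sum_range_zero, Pi.sub_apply, Pi.sub_apply, hv₁, hv₁, hvB, hvB,
        if_pos (by omega), if_pos le_rfl, if_pos rfl, if_neg one_ne_zero]
      ring
    have hc₂ : (ψ₁ - ψB) (zS, cu) = 0 := by rw [Pi.sub_apply, hc₁, hcB, sub_self]
    refine ⟨ψ₁, ψ₁ - ψB,
      -((ν ((glInt 2 F).prod (glInt 1 F))).toReal : ℂ) / ((Nat.card (IsLocalRing.ResidueField 𝒪[F]) : ℂ) - 1),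
      ((ν ((glInt 2 F).prod (glInt 1 F))).toReal : ℂ) * (Nat.card (IsLocalRing.ResidueField 𝒪[F]) : ℂ) /
        ((Nat.card (IsLocalRing.ResidueField 𝒪[F]) : ℂ) - 1),
      0, ((ν ((glInt 2 F).prod (glInt 1 F))).toReal : ℂ), hsψ₁, hsψ₂, ?_, ?_, ?_⟩
    · refine Filter.eventually_atTop.2 ⟨1, fun n hn => ?_⟩
      obtain ⟨k, rfl⟩ := Nat.exists_eq_add_of_le hn
      intro ρ _ _ hρ
      refine (hgerm₁ k ρ hρ).trans ?_
      rw [hS₁, hc₁]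
      beta_reduce
      rw [pow_add, pow_one]
      field_simp
      ring
    · refine Filter.eventually_atTop.2 ⟨1, fun n hn => ?_⟩
      obtain ⟨k, rfl⟩ := Nat.exists_eq_add_of_le hn
      intro ρ _ _ hρ
      refine (hgerm₂ k ρ hρ).trans ?_
      rw [hS₂, hc₂]
      beta_reduce
      rw [pow_add, pow_one, zero_div, add_zero, sub_zero, zero_add]
      ring
    · rw [zero_mul, sub_zero]
      exact mul_ne_zero (div_ne_zero (neg_ne_zero.2 hw0) hq1) hw0
  · -- (v) THE SHELL KIT: the deepest shell `y_n = X_n (γ_n, c) X_n⁻¹ → (z·η, c)` and the coherent-positivity criterion (★ FILE N)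
    have hdetY : Matrix.det !![(z : F), 0; z, z] ≠ 0 := by
      rw [Matrix.det_fin_two_of]; simp [z.ne_zero]
    refine ⟨fun n => ((rm n)⁻¹ * γ n * rm n, cu), (Matrix.GeneralLinearGroup.mkOfDetNeZero _ hdetY, cu), fun n => ?_, rfl, rfl,
      K2E3GLTwoRamifiedRayUnipotentShell.tendsto_deepShell hϖ hu hv z cu hγ hrm rfl, fun ψ hψ hcoh hpos => ?_⟩
    · refine ⟨(((rm n)⁻¹, 1) : GL (Fin 2) F × GL (Fin 1) F), ?_⟩
      simp only [Prod.mk_mul_mk, Prod.inv_mk, inv_inv, one_mul, inv_one, mul_one]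
    · obtain ⟨a, b, hev, -⟩ := hmain ψ hψ
      have hne := K2E3GLTwoRamifiedRayUnipotentShell.eventually_orbitalIntegral_ne_zero_of_coherent hϖ hu hu1 hv1 hdisc z cu hγτ hγ hrm ν hψ hcoh hpos
      filter_upwards [hev, hne] with n hn hn'
      obtain ⟨ρ₀, h1, h2, h3⟩ := exists_isHaarMeasure_compactCore_centralizer_pair_eq_one hϖ hu hu1 hv1 hγτ (hCn n) cu
      haveI := h1
      haveI := h2
      exact ⟨a + b * (Nat.card (IsLocalRing.ResidueField 𝒪[F]) : ℂ) ^ n, fun h0 => hn' ρ₀ h3 ((hn ρ₀ h3).trans h0), fun ρ _ _ hρ => hn ρ hρ⟩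

end Summit.HodgeConjecture.HodgeConjecture.Cruxes.H413.K2E3GLTwoCentralGermShellKit

end
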